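import Literature.AlgebraicGeometry.Motives.TateAbelianFiniteLatticeProofs
import HarnessLib

/-!
# Discharge of the finite-level lattice realization fact `exists_isogeny_range_tateModuleMap_eq`

`Literature.AlgebraicGeometry.Motives.AbelianVariety.exists_isogeny_range_tateModuleMap_eq P ℓ`
(`TateAbelianFiniteLattice`; Tate, Invent. Math. 2 (1966), §2, p. 136; Milne, *The Work of John
Tate*, §4.3.1 (b); Kieffer 2024, Prop. 1.2.4–1.2.5 with Prop. 1.1.10, 1.1.12–1.1.13): over a
perfect field `K` with `(ℓ : K) ≠ 0`, every `Γ_K`-stable `ℤ_ℓ`-submodule `X` of `T_ℓ P` with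
`ℓⁿ T_ℓ P ⊆ X` is the image `T_ℓ(f)(T_ℓ B)` of an isogeny `f : B → P` admitting an isogeny
`h : P → B` with `f ∘ h = [ℓⁿ]_P`, `h ∘ f = [ℓⁿ]_B`.

The proof is the in-tree reduction
`AbelianVariety.exists_isogeny_range_tateModuleMap_eq_of_quotient` (`TateAbelianFiniteLattice`:
`B = P / S` with `S = X / ℓⁿ T_ℓ P ⊆ P[ℓⁿ](K̄)` the image of `X` under the `n`-th projection, and
the Tate-module chase of Kieffer 2024, proof of Prop. 1.2.5) applied to the proved quotient fact
`AbelianVariety.exists_quotient_isogeny_holds` (`TateAbelianFiniteLatticeProofs`: the quotient of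
an abelian variety by a finite `Γ_K`-stable subgroup, Kieffer 2024 Prop. 1.1.10 / Mumford §7
Thm. 4 / Görtz–Wedhorn II Thm. 27.68, with the factorisation of `[ℓⁿ]`, Prop. 1.1.12–1.1.13).
No definition, statement or named fact is introduced.

## References

* [Kieffer2024IsogenyGraphs] J. Kieffer, *Isogeny graphs of abelian varieties over finite
  fields* (2024), Prop. 1.1.10 (p. 10), Prop. 1.1.12–1.1.13 (p. 11), Prop. 1.2.4 (p. 21),
  Prop. 1.2.5 (p. 22); held, read.
* [Milne2013WorkOfTate] J. S. Milne, *The Work of John Tate*, §4.3.1 (b) (arXiv:1210.7459, p. 22).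
* [Tate1966Endomorphisms] J. Tate, *Endomorphisms of abelian varieties over finite fields*,
  Invent. Math. 2 (1966), 134–144, §2, p. 136.
* [MumfordAV1970] D. Mumford, *Abelian Varieties* (1970), §7 Thm. 4 (p. 72).
-/

noncomputable section

universe u

open CategoryTheory

namespace Literature.AlgebraicGeometry.Motives

namespace AbelianVariety

variable {K : Type u} [Field K] (P : AbelianVariety K) (ℓ : ℕ) [Fact ℓ.Prime]

/-- **Finite-level lattice realization** (discharge of the named fact
`exists_isogeny_range_tateModuleMap_eq`): over a perfect field `K` with `(ℓ : K) ≠ 0`, every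
`Γ_K`-stable `ℤ_ℓ`-submodule `X` of `T_ℓ P` containing `ℓⁿ T_ℓ P` is `T_ℓ(f)(T_ℓ B)` for an
isogeny `f : B → P` with an isogeny `h : P → B`, `f ∘ h = [ℓⁿ]_P`, `h ∘ f = [ℓⁿ]_B`
(Tate 1966, §2, p. 136: the lattices `X_n` and the isogenies `B_n → A`; Milne, *The Work of
John Tate*, §4.3.1 (b)). Proof: `exists_isogeny_range_tateModuleMap_eq_of_quotient` (the
quotient `B = P/S`, `S = X / ℓⁿ T_ℓ P`, and the Tate-module chase of Kieffer 2024, proof of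
Prop. 1.2.5) fed with the proved quotient fact `exists_quotient_isogeny_holds`
(Kieffer 2024, Prop. 1.1.10 with Prop. 1.1.12–1.1.13).
[cite: Kieffer2024IsogenyGraphs, Prop. 1.2.4–1.2.5 with Prop. 1.1.10 and Prop. 1.1.12–1.1.13] -/
theorem exists_isogeny_range_tateModuleMap_eq_holds : exists_isogeny_range_tateModuleMap_eq P ℓ :=
  exists_isogeny_range_tateModuleMap_eq_of_quotient P ℓ (exists_quotient_isogeny_holds P ℓ)

end AbelianVariety

end Literature.AlgebraicGeometry.Motives
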